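import Summits.Ventures.YMGap.Thresholds.StateLipschitz
import Summits.Ventures.YMGap.SlabAreaLawDimensions
import HarnessLib

/-!
# Venture YMGap — STATE-LIPSCHITZ, rows: the mean plaquette is Lipschitz in the coupling; hypothesis-free
# instances for every `SU(N)` (Bakry–Émery modulus) and for `SU(2)`, `d = 4` (quarter modulus)

HONEST FRAMING: venture file of the cell `pub-ymgap` (QuantumFields programme), seat ds-1; companion of
`Thresholds/StateLipschitz.lean`.  Strong-coupling LATTICE statements for `SU(N)` lattice Yang–Mills on `ℤ^d`
(Wilson action) inside the ONE-LINK Dobrushin window; Lipschitz statements (not `C¹`, not analyticity);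
nothing about the continuum, confinement at weak coupling, or the Clay problem.

CONTENTS (bookkeeping over `StateLipschitz.abs_integral_sub_integral_le_of_oneLinkKRModulus`).
* `isLipBound_plaquetteObs` — the plaquette observable `Re tr U_p` has Frobenius-Lipschitz vector `√N · 𝟙_{edges(p)}`
  (`re_trace_holonomy_update`: `Re tr U_p = Re tr(U_y · staple)`).
* `abs_plaquette_sub_plaquette_le` — THE MEAN PLAQUETTE IS LIPSCHITZ IN THE COUPLING on the window:
  `|⟨Re tr U_p⟩_μ − ⟨Re tr U_p⟩_ν| ≤ 8(d−1) N K |β − β'| / (1 − c)` for DLR states `μ` at `β`, `ν` at `β'` — no jump of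
  the internal energy inside the window (the kernel form of «no first-order transition there», as a Lipschitz bound).
* `abs_integral_sub_integral_le_SU` — every `N ≥ 2`, every `d ≥ 2`, HYPOTHESIS-FREE via the tree's Bakry–Émery
  modulus `oneLinkKRModulus_SU` (`K = 1/(1/2 − R)`): for `|β|, |β'| ≤ b₀ < 1/(16(d−1))` (Shen–Zhu–Zhu's window),
  `|μ f − ν f| ≤ (2(d−1)√N/(1/2 − 8(d−1)b₀)) · |β − β'| · Σ δ(f)`.
* `su2_abs_integral_sub_integral_le`, `su2_abs_plaquette_sub_plaquette_le` — `SU(2)`, `d = 4`, Wilson units,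
  HYPOTHESIS-FREE via the tree's quarter modulus (`SlabAreaLawDimensions.su2_oneLinkKRModulus_one_one`, `K = 1` on `‖B‖_op ≤ 1`):
  for `0 ≤ β_W < 2/9` and any `0 ≤ β'_W ≤ 2/3`, `|μ f − ν f| ≤ (3√2 |β_W − β'_W| / (2 − 9β_W)) Σ δ(f)` and
  `|⟨Re tr U_p⟩_μ − ⟨Re tr U_p⟩_ν| ≤ 24 |β_W − β'_W| / (2 − 9β_W)` (normalised plaquette: `12 |Δβ_W|/(2 − 9β_W)`).

References (mechanism; nothing cited as a named fact): H. Föllmer, LNM 1362 (1988), Ch. I, Comparison Theorem (2.8);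
H.-O. Georgii, *Gibbs Measures and Phase Transitions* (2011), Thm. 8.20, Cor. 8.23–8.24; H. Shen, R. Zhu, X. Zhu,
CMP 400 (2023) 805–851, Lemma 4.1 (the Bakry–Émery one-link bound).
-/

noncomputable section

open MeasureTheory Function Finset ProbabilityTheory
open scoped NNReal
open Literature.Probability.LatticeModels
open Literature.Probability.LatticeModels.DobrushinMetric
open Literature.MathematicalPhysics.QuantumLattice
open Literature.MathematicalPhysics.QuantumFieldTheory hiding ZdEdge
open Literature.MathematicalPhysics.QuantumFieldTheory.Balaban1983to89.StrongCouplingDobrushinWindow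
open Literature.MathematicalPhysics.QuantumFieldTheory.Balaban1983to89.StrongCouplingKernelWindow
  (oneLinkKRModulus_SU)
open Summit.Ventures.YMGap.SlabAreaLawDimensions (su2_oneLinkKRModulus_one_one)
open Summit.Ventures.YMGap.StateLipschitz

namespace Summit.Ventures.YMGap.StateLipschitzRows

variable {d N : ℕ}

/-! ## §1 The mean plaquette is Lipschitz in the coupling -/

/-- **The plaquette observable `Re tr U_p` has Frobenius-Lipschitz vector `√N · 𝟙_{edges(p)}`**: changing the link
`y ∈ p` changes `Re tr U_p = Re tr(U_y · staple)` by at most `‖U_y − U'_y‖_F · ‖staple‖_F = √N ‖U_y − U'_y‖_F`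
(`re_trace_holonomy_update`, `abs_re_trace_su_mul_sub_le`); links off `p` are not read. [folklore] -/
theorem isLipBound_plaquetteObs (p : ZdPlaquette d) :
    IsLipBound suFrobDist (plaquetteObs (fundamentalRep (Fin N)) p.1 p.2.1.1 p.2.1.2)
      fun y => if y ∈ plaquetteEdges p then Real.sqrt N else 0 := by
  classical
  refine ⟨fun y => by split_ifs <;> positivity, fun y σ τ hστ => ?_⟩
  split_ifs with hy
  · have hσ : σ = Function.update τ y (σ y) := by
      funext z
      by_cases hz : z = y
      · subst hz; simp
      · rw [Function.update_of_ne hz, hστ z hz]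
    have hτ : τ = Function.update τ y (τ y) := (Function.update_eq_self y τ).symm
    have eσ : plaquetteObs (fundamentalRep (Fin N)) p.1 p.2.1.1 p.2.1.2 σ =
        (((σ y : Matrix.specialUnitaryGroup (Fin N) ℂ) : Matrix (Fin N) (Fin N) ℂ) *
          ((staple p y τ : Matrix.specialUnitaryGroup (Fin N) ℂ) : Matrix (Fin N) (Fin N) ℂ)).trace.re := by
      conv_lhs => rw [hσ]
      unfold plaquetteObs
      rw [re_trace_holonomy_update (fundamentalRep (Fin N)) fundamentalRep_mem_unitaryGroup hy τ (σ y)]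
      simp only [fundamentalRep_apply]
    have eτ : plaquetteObs (fundamentalRep (Fin N)) p.1 p.2.1.1 p.2.1.2 τ =
        (((τ y : Matrix.specialUnitaryGroup (Fin N) ℂ) : Matrix (Fin N) (Fin N) ℂ) *
          ((staple p y τ : Matrix.specialUnitaryGroup (Fin N) ℂ) : Matrix (Fin N) (Fin N) ℂ)).trace.re := by
      conv_lhs => rw [hτ]
      unfold plaquetteObs
      rw [re_trace_holonomy_update (fundamentalRep (Fin N)) fundamentalRep_mem_unitaryGroup hy τ (τ y)]
      simp only [fundamentalRep_apply]
    rw [eσ, eτ]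
    refine (abs_re_trace_su_mul_sub_le (σ y) (τ y) _).trans ?_
    rw [frobNorm_su, mul_comm]
  · have hdep : DependsOn (plaquetteObs (fundamentalRep (Fin N)) p.1 p.2.1.1 p.2.1.2)
        (↑(plaquetteEdges p) : Set (ZdEdge d)) := isCylinder_plaquetteObs (fundamentalRep (Fin N)) p
    have heq : plaquetteObs (fundamentalRep (Fin N)) p.1 p.2.1.1 p.2.1.2 σ =
        plaquetteObs (fundamentalRep (Fin N)) p.1 p.2.1.1 p.2.1.2 τ :=
      hdep fun z hz => hστ z (fun hzy => hy (hzy ▸ (Finset.mem_coe.1 hz)))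
    rw [heq, sub_self, abs_zero, zero_mul]

/-- The plaquette observable of the fundamental representation is continuous, hence measurable, on the product
space. [folklore] -/
theorem measurable_plaquetteObs_fundamental (p : ZdPlaquette d) :
    Measurable (plaquetteObs (d := d) (fundamentalRep (Fin N)) p.1 p.2.1.1 p.2.1.2) := by
  haveI : SecondCountableTopology (Matrix (Fin N) (Fin N) ℂ) :=
    inferInstanceAs (SecondCountableTopology (Fin N → Fin N → ℂ))
  haveI : SecondCountableTopology (Matrix.specialUnitaryGroup (Fin N) ℂ) :=
    Topology.IsEmbedding.subtypeVal.secondCountableTopology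
  have hcont : Continuous (plaquetteObs (d := d) (fundamentalRep (Fin N)) p.1 p.2.1.1 p.2.1.2) := by
    unfold plaquetteObs plaquetteHolonomyZd
    refine Complex.continuous_re.comp (Continuous.matrix_trace ((continuous_fundamentalRep (Fin N)).comp ?_))
    fun_prop
  exact hcont.measurable

/-- **The mean plaquette is Lipschitz in the coupling on the one-link window.**  With the data of
`abs_integral_sub_integral_le_of_oneLinkKRModulus`, for every plaquette `p` of `ℤ^d` and DLR states `μ` at `β`,
`ν` at `β'`: `|⟨Re tr U_p⟩_μ − ⟨Re tr U_p⟩_ν| ≤ 8(d−1) N K |β − β'| / (1 − c)`, i.e. for the normalised plaquette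
`u = ⟨(1/N) Re tr U_p⟩` the Lipschitz constant `8(d−1)K/(1−c)` in the 't Hooft coupling — no jump of the internal
energy inside the window. [cite: Follmer1988, Ch. I Comparison Theorem (2.8)] -/
theorem abs_plaquette_sub_plaquette_le (hd : 2 ≤ d) (hN : 2 ≤ N) {β β' R K : ℝ} (hK : 0 ≤ K)
    (hR : |β| * (2 * ((d : ℝ) - 1)) ≤ R) (hR' : |β'| * (2 * ((d : ℝ) - 1)) ≤ R)
    (hmod : OneLinkKRModulus N R K) (hsmall : 6 * ((d : ℝ) - 1) * |β| * K < 1)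
    {μ ν : Measure (LGConfig d (Matrix.specialUnitaryGroup (Fin N) ℂ))}
    (hμ : μ ∈ ymGibbsMeasures (d := d) (fundamentalRep (Fin N)) (N * β))
    (hν : ν ∈ ymGibbsMeasures (d := d) (fundamentalRep (Fin N)) (N * β')) (p : ZdPlaquette d) :
    |(∫ σ, plaquetteObs (fundamentalRep (Fin N)) p.1 p.2.1.1 p.2.1.2 σ ∂μ) -
        ∫ σ, plaquetteObs (fundamentalRep (Fin N)) p.1 p.2.1.1 p.2.1.2 σ ∂ν| ≤
      8 * ((d : ℝ) - 1) * N * K * |β - β'| / (1 - 6 * ((d : ℝ) - 1) * |β| * K) := by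
  classical
  have hd2 : (2 : ℝ) ≤ d := by exact_mod_cast hd
  have h1c : 0 < 1 - 6 * ((d : ℝ) - 1) * |β| * K := sub_pos.2 hsmall
  have key := abs_integral_sub_integral_le_of_oneLinkKRModulus hd hN hK hR hR' hmod hsmall hμ hν
    (measurable_plaquetteObs_fundamental p) (isCylinder_plaquetteObs (fundamentalRep (Fin N)) p)
    (abs_plaquetteObs_le_holds (fundamentalRep (Fin N)) fundamentalRep_mem_unitaryGroup p.1 p.2.1.1 p.2.1.2)
    (isLipBound_plaquetteObs p)
  have hsum : ∑ y ∈ plaquetteEdges p, (if y ∈ plaquetteEdges p then Real.sqrt N else 0) ≤ 4 * Real.sqrt N := by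
    rw [Finset.sum_ite_of_true (fun y hy => hy), Finset.sum_const, nsmul_eq_mul]
    exact mul_le_mul_of_nonneg_right (by exact_mod_cast card_plaquetteEdges_le p) (Real.sqrt_nonneg _)
  have hpre : 0 ≤ K * (2 * ((d : ℝ) - 1) * Real.sqrt N) * |β - β'| / (1 - 6 * ((d : ℝ) - 1) * |β| * K) := by
    have : 0 ≤ (d : ℝ) - 1 := by linarith
    positivity
  refine key.trans ((mul_le_mul_of_nonneg_left hsum hpre).trans (le_of_eq ?_))
  have hNN : Real.sqrt N * Real.sqrt N = N := Real.mul_self_sqrt (Nat.cast_nonneg N)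
  rw [div_mul_eq_mul_div]
  congr 1
  calc K * (2 * ((d : ℝ) - 1) * Real.sqrt N) * |β - β'| * (4 * Real.sqrt N)
      = 8 * ((d : ℝ) - 1) * (Real.sqrt N * Real.sqrt N) * K * |β - β'| := by ring
    _ = 8 * ((d : ℝ) - 1) * N * K * |β - β'| := by rw [hNN]

/-! ## §2 Rows: hypothesis-free instances -/

/-- **Every `SU(N)`, every `d ≥ 2`, hypothesis-free** (Bakry–Émery one-link modulus `K = 1/(1/2 − R)` of the tree,
`oneLinkKRModulus_SU`): for 't Hooft couplings `|β|, |β'| ≤ b₀ < 1/(16(d−1))` (Shen–Zhu–Zhu's window), DLR states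
`μ` at `β` and `ν` at `β'`, and every bounded local `f` with Frobenius-Lipschitz vector `δ` on `Δ`:
`|∫ f dμ − ∫ f dν| ≤ (2(d−1)√N / (1/2 − 8(d−1) b₀)) · |β − β'| · Σ_{y∈Δ} δ_y`.
[cite: arXiv220412737, Lemma 4.1 with (4.7)-(4.8), Cor. 4.4 (4.11) and Rem. 1.3] -/
theorem abs_integral_sub_integral_le_SU (hd : 2 ≤ d) (hN : 2 ≤ N) {b₀ β β' : ℝ}
    (hb₀ : b₀ < 1 / (16 * ((d : ℝ) - 1))) (hβ : |β| ≤ b₀) (hβ' : |β'| ≤ b₀)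
    {μ ν : Measure (LGConfig d (Matrix.specialUnitaryGroup (Fin N) ℂ))}
    (hμ : μ ∈ ymGibbsMeasures (d := d) (fundamentalRep (Fin N)) (N * β))
    (hν : ν ∈ ymGibbsMeasures (d := d) (fundamentalRep (Fin N)) (N * β'))
    {f : LGConfig d (Matrix.specialUnitaryGroup (Fin N) ℂ) → ℝ} (hfm : Measurable f)
    {Δ : Finset (ZdEdge d)} (hfdep : DependsOn f (↑Δ : Set (ZdEdge d))) {M : ℝ} (hM : ∀ σ, |f σ| ≤ M)
    {δ : ZdEdge d → ℝ} (hδ : IsLipBound suFrobDist f δ) :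
    |(∫ σ, f σ ∂μ) - ∫ σ, f σ ∂ν| ≤
      2 * ((d : ℝ) - 1) * Real.sqrt N / (1 / 2 - 8 * ((d : ℝ) - 1) * b₀) * |β - β'| * ∑ y ∈ Δ, δ y := by
  have hd2 : (2 : ℝ) ≤ d := by exact_mod_cast hd
  have hd0 : (0 : ℝ) < (d : ℝ) - 1 := by linarith
  have hb₀0 : 0 ≤ b₀ := (abs_nonneg β).trans hβ
  have h16 : 16 * ((d : ℝ) - 1) * b₀ < 1 := by
    have h := (lt_div_iff₀ (by positivity : (0 : ℝ) < 16 * ((d : ℝ) - 1))).1 hb₀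
    linarith [mul_comm b₀ (16 * ((d : ℝ) - 1))]
  set R : ℝ := 2 * ((d : ℝ) - 1) * b₀ with hRdef
  have hRhalf : R < 1 / 2 := by rw [hRdef]; nlinarith
  have hA : 0 < 1 / 2 - R := sub_pos.2 hRhalf
  set K : ℝ := 1 / (1 / 2 - R) with hKdef
  have hK : 0 ≤ K := by rw [hKdef]; positivity
  have hmod : OneLinkKRModulus N R K := oneLinkKRModulus_SU hN hRhalf
  have hRβ : |β| * (2 * ((d : ℝ) - 1)) ≤ R := by rw [hRdef]; nlinarith
  have hRβ' : |β'| * (2 * ((d : ℝ) - 1)) ≤ R := by rw [hRdef]; nlinarith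
  -- the Dobrushin constant at `β`
  have hden : 0 < 1 / 2 - 8 * ((d : ℝ) - 1) * b₀ := by nlinarith
  have hgap : 1 / 2 - 8 * ((d : ℝ) - 1) * b₀ ≤ 1 / 2 - R - 6 * ((d : ℝ) - 1) * |β| := by
    rw [hRdef]; nlinarith
  have hsmall : 6 * ((d : ℝ) - 1) * |β| * K < 1 := by
    rw [hKdef, ← mul_div_assoc, mul_one, div_lt_one hA]
    linarith
  have key := abs_integral_sub_integral_le_of_oneLinkKRModulus hd hN hK hRβ hRβ' hmod hsmall hμ hν hfm
    hfdep hM hδ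
  refine key.trans ?_
  have hS : 0 ≤ ∑ y ∈ Δ, δ y := Finset.sum_nonneg fun y _ => hδ.nonneg y
  -- `K / (1 − 6(d−1)|β|K) = 1 / (1/2 − R − 6(d−1)|β|) ≤ 1 / (1/2 − 8(d−1)b₀)`
  have hK' : K = (1 / 2 - R)⁻¹ := by rw [hKdef, one_div]
  have h1 : 1 - 6 * ((d : ℝ) - 1) * |β| * K = (1 / 2 - R - 6 * ((d : ℝ) - 1) * |β|) / (1 / 2 - R) := by
    rw [hK', eq_div_iff hA.ne', sub_mul, one_mul, mul_assoc (6 * ((d : ℝ) - 1) * |β|),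
      inv_mul_cancel₀ hA.ne', mul_one]
  have hquot : K / (1 - 6 * ((d : ℝ) - 1) * |β| * K) = 1 / (1 / 2 - R - 6 * ((d : ℝ) - 1) * |β|) := by
    rw [h1, hK', div_div_eq_mul_div, inv_mul_cancel₀ hA.ne', one_div]
  have hquot_le : K / (1 - 6 * ((d : ℝ) - 1) * |β| * K) ≤ 1 / (1 / 2 - 8 * ((d : ℝ) - 1) * b₀) := by
    rw [hquot]
    exact one_div_le_one_div_of_le hden hgap
  calc K * (2 * ((d : ℝ) - 1) * Real.sqrt N) * |β - β'| / (1 - 6 * ((d : ℝ) - 1) * |β| * K) * ∑ y ∈ Δ, δ y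
      = K / (1 - 6 * ((d : ℝ) - 1) * |β| * K) * (2 * ((d : ℝ) - 1) * Real.sqrt N * |β - β'| * ∑ y ∈ Δ, δ y) := by
        ring
    _ ≤ 1 / (1 / 2 - 8 * ((d : ℝ) - 1) * b₀) * (2 * ((d : ℝ) - 1) * Real.sqrt N * |β - β'| * ∑ y ∈ Δ, δ y) :=
        mul_le_mul_of_nonneg_right hquot_le (by positivity)
    _ = 2 * ((d : ℝ) - 1) * Real.sqrt N / (1 / 2 - 8 * ((d : ℝ) - 1) * b₀) * |β - β'| * ∑ y ∈ Δ, δ y := by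
        ring

/-- **`SU(2)`, `d = 4`, Wilson units, hypothesis-free**: for Wilson couplings `0 ≤ β_W < 2/9` (the one-link window of
the quarter modulus, Dobrushin constant `9β_W/2`) and ANY `0 ≤ β'_W ≤ 2/3`, DLR states `μ` at `β_W` and `ν` at `β'_W`
(bare tree coupling `2 · (β_W/4) = β_W/2`), and every bounded local `f` with Frobenius-Lipschitz vector `δ` on `Δ`:
`|∫ f dμ − ∫ f dν| ≤ (3√2 · |β_W − β'_W| / (2 − 9 β_W)) · Σ_{y∈Δ} δ_y`.
[cite: Follmer1988, Ch. I Comparison Theorem (2.8)] -/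
theorem su2_abs_integral_sub_integral_le {βW βW' : ℝ} (h0 : 0 ≤ βW) (h29 : βW < 2 / 9)
    (h0' : 0 ≤ βW') (h23 : βW' ≤ 2 / 3)
    {μ ν : Measure (LGConfig 4 (Matrix.specialUnitaryGroup (Fin 2) ℂ))}
    (hμ : μ ∈ ymGibbsMeasures (d := 4) (fundamentalRep (Fin 2)) (2 * (βW / 4)))
    (hν : ν ∈ ymGibbsMeasures (d := 4) (fundamentalRep (Fin 2)) (2 * (βW' / 4)))
    {f : LGConfig 4 (Matrix.specialUnitaryGroup (Fin 2) ℂ) → ℝ} (hfm : Measurable f)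
    {Δ : Finset (ZdEdge 4)} (hfdep : DependsOn f (↑Δ : Set (ZdEdge 4))) {M : ℝ} (hM : ∀ σ, |f σ| ≤ M)
    {δ : ZdEdge 4 → ℝ} (hδ : IsLipBound suFrobDist f δ) :
    |(∫ σ, f σ ∂μ) - ∫ σ, f σ ∂ν| ≤ 3 * Real.sqrt 2 * |βW - βW'| / (2 - 9 * βW) * ∑ y ∈ Δ, δ y := by
  have hR : |βW / 4| * (2 * (((4 : ℕ) : ℝ) - 1)) ≤ 1 := by
    rw [abs_of_nonneg (by positivity)]; push_cast; linarith
  have hR' : |βW' / 4| * (2 * (((4 : ℕ) : ℝ) - 1)) ≤ 1 := by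
    rw [abs_of_nonneg (by positivity)]; push_cast; linarith
  have hs : 6 * (((4 : ℕ) : ℝ) - 1) * |βW / 4| * 1 < 1 := by
    rw [abs_of_nonneg (by positivity)]; push_cast; linarith
  have key := abs_integral_sub_integral_le_of_oneLinkKRModulus (d := 4) (N := 2) (by norm_num) le_rfl
    zero_le_one hR hR' su2_oneLinkKRModulus_one_one hs hμ hν hfm hfdep hM hδ
  have he : (1 : ℝ) * (2 * (((4 : ℕ) : ℝ) - 1) * Real.sqrt ((2 : ℕ) : ℝ)) * |βW / 4 - βW' / 4| /
      (1 - 6 * (((4 : ℕ) : ℝ) - 1) * |βW / 4| * 1) = 3 * Real.sqrt 2 * |βW - βW'| / (2 - 9 * βW) := by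
    have h9 : (2 : ℝ) - 9 * βW ≠ 0 := by linarith
    rw [abs_of_nonneg (by positivity : (0 : ℝ) ≤ βW / 4), show βW / 4 - βW' / 4 = (βW - βW') / 4 by ring, abs_div,
      abs_of_pos (by norm_num : (0 : ℝ) < 4)]
    push_cast
    rw [div_eq_div_iff (by linarith) h9]
    ring
  rw [he] at key
  exact key

/-- **`SU(2)`, `d = 4`: the mean plaquette is Lipschitz in the Wilson coupling**, hypothesis-free: for
`0 ≤ β_W < 2/9`, `0 ≤ β'_W ≤ 2/3` and DLR states `μ`, `ν` at `β_W`, `β'_W`: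
`|⟨Re tr U_p⟩_μ − ⟨Re tr U_p⟩_ν| ≤ 24 |β_W − β'_W| / (2 − 9 β_W)` (so the normalised plaquette `⟨½ Re tr U_p⟩` moves by at
most `12 |β_W − β'_W| / (2 − 9β_W)`). [cite: Follmer1988, Ch. I Comparison Theorem (2.8)] -/
theorem su2_abs_plaquette_sub_plaquette_le {βW βW' : ℝ} (h0 : 0 ≤ βW) (h29 : βW < 2 / 9)
    (h0' : 0 ≤ βW') (h23 : βW' ≤ 2 / 3)
    {μ ν : Measure (LGConfig 4 (Matrix.specialUnitaryGroup (Fin 2) ℂ))}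
    (hμ : μ ∈ ymGibbsMeasures (d := 4) (fundamentalRep (Fin 2)) (2 * (βW / 4)))
    (hν : ν ∈ ymGibbsMeasures (d := 4) (fundamentalRep (Fin 2)) (2 * (βW' / 4))) (p : ZdPlaquette 4) :
    |(∫ σ, plaquetteObs (fundamentalRep (Fin 2)) p.1 p.2.1.1 p.2.1.2 σ ∂μ) -
        ∫ σ, plaquetteObs (fundamentalRep (Fin 2)) p.1 p.2.1.1 p.2.1.2 σ ∂ν| ≤
      24 * |βW - βW'| / (2 - 9 * βW) := by
  have hR : |βW / 4| * (2 * (((4 : ℕ) : ℝ) - 1)) ≤ 1 := by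
    rw [abs_of_nonneg (by positivity)]; push_cast; linarith
  have hR' : |βW' / 4| * (2 * (((4 : ℕ) : ℝ) - 1)) ≤ 1 := by
    rw [abs_of_nonneg (by positivity)]; push_cast; linarith
  have hs : 6 * (((4 : ℕ) : ℝ) - 1) * |βW / 4| * 1 < 1 := by
    rw [abs_of_nonneg (by positivity)]; push_cast; linarith
  have key := abs_plaquette_sub_plaquette_le (d := 4) (N := 2) (by norm_num) le_rfl zero_le_one hR hR'
    su2_oneLinkKRModulus_one_one hs hμ hν p
  have he : 8 * (((4 : ℕ) : ℝ) - 1) * ((2 : ℕ) : ℝ) * 1 * |βW / 4 - βW' / 4| /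
      (1 - 6 * (((4 : ℕ) : ℝ) - 1) * |βW / 4| * 1) = 24 * |βW - βW'| / (2 - 9 * βW) := by
    have h9 : (2 : ℝ) - 9 * βW ≠ 0 := by linarith
    rw [abs_of_nonneg (by positivity : (0 : ℝ) ≤ βW / 4), show βW / 4 - βW' / 4 = (βW - βW') / 4 by ring, abs_div,
      abs_of_pos (by norm_num : (0 : ℝ) < 4)]
    push_cast
    rw [div_eq_div_iff (by linarith) h9]
    ring
  rw [he] at key
  exact key

end Summit.Ventures.YMGap.StateLipschitzRows

end
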